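import Summits.AtomisticToContinuum.HydrodynamicLimit.Theorems.JParityClosureLocalSecondLawKineticStressRegularity

/-!
# P1 from kinetic isotropy and strain tightness — the conditional form of `stub_passivityKinetic`
(stmt-AtomisticToContinuum-13081, line `exact-entropy-ledger-three-passivities`)

The registered stub `stub_passivityKinetic` (P1: `P(Regular ∧ T₁ < −η) ≤ δ` eventually, in the crux's frame) is,
as registered, the open local-Maxwellisation statement of the route (its `T₁` is an honest integral on `Regular`,
`T1_honest_of_regular`, so no junk escape exists).  This file isolates the WEAKEST pair of in-probability inputs from
which it follows by the deterministic core `abs_T1_le_of_regular` and a union bound, both written in the crux's own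
frame and INLINED as the two hypotheses of the theorem (their Lean texts are displayed below, ready to be registered
as stubs `KineticIsotropyRate`, `StrainTightness` of the crux; no `def … : Prop` is introduced here):

* `KineticIsotropyRate` — the statement about the coarse kinetic stress: on the regular event,
  `∫₀^τ∫ ∑ₖₗ |Σ^dev_{r,kl}| ≤ η r` with probability `≥ 1 − δ` for `r < r₀`, `N ≥ N₀(r)` (kinetic anisotropy
  vanishes in `L¹([0,τ] × 𝕋³)` at rate `r`).  PRE-SHOCK producers: OddContactSymmetry (13078) + RateFloor (13080)
  + EmpiricalEnskogIdentity (13086) + CollisionTightness (13085) + ParitySplit (13083) ⇒ vanishing even production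
  ⇒ ParityRigidity (13084) ⇒ local Maxwellian limit law, upgraded from LAW to STRESS by KineticEnergyTails (13087),
  with DensityCap (13082) keeping the cutoffs off: the unresolved part of `Σ^dev_r` vanishes as `N → ∞` and the
  resolved part is `O(r²‖∇u‖²) = o(r)`.  Post-shock it is the line's bet (N3).
* `StrainTightness` — the statement about the weight: `r |∂ₖu_{r,l}| ≤ K` on `[0,τ] × 𝕋³` with probability
  `≥ 1 − δ`.  DETERMINISTIC on `Regular ∩ {e_r ≤ E on [0,τ] × 𝕋³}` (a local energy cap — "no hot spots" — gives
  `|∇u_r| ≤ C(c, η₁/σ³, E)/r`: the cone derivative `(3/(πr⁴))𝟙_{d<r}` weighs the `O((η₁/σ³)r³)` particles of the ball,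
  each of peculiar speed `O(√(E/c))`); on `Regular` ALONE only `C(c, η₁/σ³)√ke · r^{-5/2}` holds (one fast particle
  near the rim), which no plausible isotropy rate beats (the resolved anisotropy is `Θ(r²)` under shear) — so either
  `Regular` (stub F) gains the cap `kinC ≤ E`, or this tightness is a separate LLN-type input (true pre-shock from the
  law of large numbers at positive times).

`passivityKinetic_of_isotropy : KineticIsotropyRate → StrainTightness → stub_passivityKinetic` (all three texts verbatim):
with `M = sup|φ|` on `[0,τ] × 𝕋³` (compactness), `K` from strain tightness at `δ/2`, isotropy at level
`ηc/((M+1)K)` and `δ/2`, the core gives `|T₁| ≤ (MK/(cr)) · (ηc/((M+1)K)) r < η` off the two exceptional events.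

References: H. Spohn, *Large Scale Dynamics of Interacting Particles* (1991), Part I §3;
S. Olla, S. R. S. Varadhan, H.-T. Yau, Commun. Math. Phys. 155 (1993) 523 (local-equilibrium closures).
-/

noncomputable section

namespace Summit.AtomisticToContinuum.HydrodynamicLimit.Theorems.LocalSecondLawLedger

open scoped BigOperators Topology Classical MeasureTheory ENNReal InnerProductSpace
open Filter Set MeasureTheory
open Literature.MathematicalPhysics.KineticTheory
open Literature.Analysis.FluidPDE
open Summit.AtomisticToContinuum.HydrodynamicLimit.Theorems.LocalSecondLawNegative

variable {N : ℕ}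


/-! ### Antecedent `KineticIsotropyRate` (inlined as the first hypothesis of `passivityKinetic_of_isotropy`)
**Kinetic isotropy at rate `r`** (`L¹`, in probability, on the regular event) — the antecedent about the
coarse kinetic stress.  In the crux's frame: for every floor/cap `(c, η₁)` and `η, δ > 0`, for `r < r₀` and
`N ≥ N₀(r)`, outside an event of probability `≤ δ` the regular orbits satisfy
`∫₀^τ∫ ∑ₖₗ |Σ^dev_{r,kl}| ≤ η r`.  PRE-SHOCK this is the local-Maxwellian limit law — OddContactSymmetry (13078) +
RateFloor (13080) + EmpiricalEnskogIdentity (13086) + CollisionTightness (13085) + ParitySplit (13083) ⇒ vanishing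
even production ⇒ ParityRigidity (13084) — upgraded from velocity LAW to kinetic STRESS by KineticEnergyTails
(13087): the unresolved part of `Σ^dev_r` then vanishes as `N → ∞` and the resolved part is `O(r²‖∇u‖²) = o(r)`
(DensityCap 13082 keeps the cutoffs off); post-shock it is the line's bet (N3).  Lean text (namespace/opens of
this file), ready to be registered as a stub:
```
∀ (a₀ θ₀ : T3 → ℝ) (u₀ : T3 → V3), Continuous a₀ → Continuous θ₀ → Continuous u₀ → (∀ x, 0 < a₀ x) → (∀ x, 0 < θ₀ x)
→ ∃ σ₀ : ℝ, 0 < σ₀ ∧ ∀ σ : ℝ, 0 < σ → σ < σ₀ → ∀ (T : ℝ) (ρ θ : ℝ → T3 → ℝ) (u : ℝ → T3 → V3),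
IsHardSphereEulerSolution σ T ρ u θ → ∀ Φ : (N : ℕ) → Flow σ N, TendstoHydroFieldsAt (fun N => localGibbsLaw σ a₀ u₀
θ₀ N (Φ N)) Φ ρ u θ 0 → 0 < T → ∀ τ : ℝ, 0 < τ → ∀ c η₁ : ℝ, 0 < c → ∀ η δ : ℝ, 0 < η → 0 < δ → ∃ r₀ : ℝ, 0 < r₀ ∧ ∀
r : ℝ, 0 < r → r < r₀ → ∃ N₀ : ℕ, ∀ N : ℕ, N₀ ≤ N → localGibbsLaw σ a₀ u₀ θ₀ N (Φ N) {z | Regular σ r τ c η₁ (Φ N) z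
∧ η * r < ∫ s in Set.Icc (0 : ℝ) τ, ∫ x : T3, ∑ k : Fin 3, ∑ l : Fin 3, |devC r ((Φ N).flow s z) x k l|} ≤
ENNReal.ofReal δ
```
-/


/-! ### Antecedent `StrainTightness` (inlined as the second hypothesis of `passivityKinetic_of_isotropy`)
**Tightness of the resolved strain at rate `1/r`** (in probability, on the regular event) — the antecedent
about the weight.  In the crux's frame: for every floor/cap `(c, η₁)` and `δ > 0` there is `K > 0` such that for
`r < r₀`, `N ≥ N₀(r)`, outside an event of probability `≤ δ` the regular orbits satisfy `r |∂ₖ u_{r,l}(s, x)| ≤ K`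
on `[0,τ] × 𝕋³`.  It is DETERMINISTIC on `Regular ∩ {e_r ≤ E on [0,τ] × 𝕋³}` (a local energy cap gives
`|∇u_r| ≤ C(c, η₁/σ³, E)/r`: the cone derivative `3/(πr⁴)𝟙_{d<r}` weighs the `O((η₁/σ³) r³)` particles of the ball,
each of peculiar speed `O(√(E/c))`); WITHOUT such a cap the regular event only gives `C(c, η₁/σ³) √ke · r^{-5/2}`
(one fast particle near the rim of the ball), which no plausible isotropy rate beats.  Pre-shock it also follows
from the law of large numbers at positive times.  Lean text, ready to be registered as a stub:
```
∀ (a₀ θ₀ : T3 → ℝ) (u₀ : T3 → V3), Continuous a₀ → Continuous θ₀ → Continuous u₀ → (∀ x, 0 < a₀ x) → (∀ x, 0 < θ₀ x)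
→ ∃ σ₀ : ℝ, 0 < σ₀ ∧ ∀ σ : ℝ, 0 < σ → σ < σ₀ → ∀ (T : ℝ) (ρ θ : ℝ → T3 → ℝ) (u : ℝ → T3 → V3),
IsHardSphereEulerSolution σ T ρ u θ → ∀ Φ : (N : ℕ) → Flow σ N, TendstoHydroFieldsAt (fun N => localGibbsLaw σ a₀ u₀
θ₀ N (Φ N)) Φ ρ u θ 0 → 0 < T → ∀ τ : ℝ, 0 < τ → ∀ c η₁ : ℝ, 0 < c → ∀ δ : ℝ, 0 < δ → ∃ K : ℝ, 0 < K ∧ ∃ r₀ : ℝ, 0 <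
r₀ ∧ ∀ r : ℝ, 0 < r → r < r₀ → ∃ N₀ : ℕ, ∀ N : ℕ, N₀ ≤ N → localGibbsLaw σ a₀ u₀ θ₀ N (Φ N) {z | Regular σ r τ c η₁
(Φ N) z ∧ ∃ s ∈ Set.Icc (0 : ℝ) τ, ∃ x : T3, ∃ k l : Fin 3, K < r * |pD k (fun y => uC r ((Φ N).flow s z) y l) x|} ≤
ENNReal.ofReal δ
```
-/


/-- **P1 from kinetic isotropy and strain tightness** (`passivityKinetic_of_isotropy`): under `KineticIsotropyRate`
and `StrainTightness` the registered stub `stub_passivityKinetic` holds VERBATIM.  Proof: with `M = sup|φ|` on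
`[0,τ] × 𝕋³`, `K` from strain tightness at `δ/2` and isotropy at level `η c/((M+1) K)`, `δ/2`, the deterministic core
gives `|T₁| ≤ (M K/(c r)) · (η c/((M+1)K)) r < η` off the two exceptional events; union bound. -/
theorem passivityKinetic_of_isotropy :
  (∀ (a₀ θ₀ : T3 → ℝ) (u₀ : T3 → V3), Continuous a₀ → Continuous θ₀ → Continuous u₀ → (∀ x, 0 < a₀ x) → (∀ x, 0 < θ₀ x) → ∃ σ₀ : ℝ, 0 < σ₀ ∧ ∀ σ : ℝ, 0 < σ → σ < σ₀ → ∀ (T : ℝ) (ρ θ : ℝ → T3 → ℝ) (u : ℝ → T3 → V3), IsHardSphereEulerSolution σ T ρ u θ → ∀ Φ : (N : ℕ) → Flow σ N, TendstoHydroFieldsAt (fun N => localGibbsLaw σ a₀ u₀ θ₀ N (Φ N)) Φ ρ u θ 0 → 0 < T → ∀ τ : ℝ, 0 < τ → ∀ c η₁ : ℝ, 0 < c → ∀ η δ : ℝ, 0 < η → 0 < δ → ∃ r₀ : ℝ, 0 < r₀ ∧ ∀ r : ℝ, 0 < r → r < r₀ → ∃ N₀ : ℕ, ∀ N : ℕ,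 N₀ ≤ N → localGibbsLaw σ a₀ u₀ θ₀ N (Φ N) {z | Regular σ r τ c η₁ (Φ N) z ∧ η * r < ∫ s in Set.Icc (0 : ℝ) τ, ∫ x : T3, ∑ k : Fin 3, ∑ l : Fin 3, |devC r ((Φ N).flow s z) x k l|} ≤ ENNReal.ofReal δ) → (∀ (a₀ θ₀ : T3 → ℝ) (u₀ : T3 → V3), Continuous a₀ → Continuous θ₀ → Continuous u₀ → (∀ x, 0 < a₀ x) → (∀ x, 0 < θ₀ x) → ∃ σ₀ : ℝ, 0 < σ₀ ∧ ∀ σ : ℝ, 0 < σ → σ < σ₀ → ∀ (T : ℝ) (ρ θ : ℝ → T3 → ℝ) (u : ℝ → T3 → V3), IsHardSphereEulerSolution σ T ρ u θ → ∀ Φ : (N : ℕ) → Flow σ N, TendstoHydroFieldsAt (fun N => localGibbsLaw σ a₀ u₀ θ₀ N (Φ N)) Φ ρ u θ 0 → 0 < T → ∀ τ : ℝ, 0 < τ → ∀ c η₁ : ℝ, 0 < c → ∀ δ : ℝ, 0 < δ → ∃ K : ℝ, 0 < K ∧ ∃ r₀ : ℝ, 0 < r₀ ∧ ∀ r : ℝ,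 0 < r → r < r₀ → ∃ N₀ : ℕ, ∀ N : ℕ, N₀ ≤ N → localGibbsLaw σ a₀ u₀ θ₀ N (Φ N) {z | Regular σ r τ c η₁ (Φ N) z ∧ ∃ s ∈ Set.Icc (0 : ℝ) τ, ∃ x : T3, ∃ k l : Fin 3, K < r * |pD k (fun y => uC r ((Φ N).flow s z) y l) x|} ≤ ENNReal.ofReal δ) → ∀ (a₀ θ₀ : T3 → ℝ) (u₀ : T3 → V3), Continuous a₀ → Continuous θ₀ → Continuous u₀ → (∀ x, 0 < a₀ x) → (∀ x, 0 < θ₀ x) → ∃ σ₀ : ℝ, 0 < σ₀ ∧ ∀ σ : ℝ, 0 < σ → σ < σ₀ → ∀ (T : ℝ) (ρ θ : ℝ → T3 → ℝ) (u : ℝ → T3 → V3), IsHardSphereEulerSolution σ T ρ u θ → ∀ Φ : (N : ℕ) → Flow σ N, TendstoHydroFieldsAt (fun N => localGibbsLaw σ a₀ u₀ θ₀ N (Φ N)) Φ ρ u θ 0 → 0 < T → ∀ τ : ℝ, 0 < τ → ∀ φ : ℝ → T3 → ℝ, Literature.Analysis.FunctionSpaces.Torus.IsSmoothSpaceTimeOn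 Set.univ φ → (∀ s x, 0 ≤ φ s x) → (∃ τ' : ℝ, τ' < τ ∧ ∀ s, τ' ≤ s → ∀ x, φ s x = 0) → ∀ c η₁ : ℝ, 0 < c → ∀ η δ : ℝ, 0 < η → 0 < δ → ∃ r₀ : ℝ, 0 < r₀ ∧ ∀ r : ℝ, 0 < r → r < r₀ → ∃ N₀ : ℕ, ∀ N : ℕ, N₀ ≤ N → localGibbsLaw σ a₀ u₀ θ₀ N (Φ N) {z | Regular σ r τ c η₁ (Φ N) z ∧ T₁ σ r τ φ (Φ N) z < -η} ≤ ENNReal.ofReal δ := by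
  intro hIso hStr a₀ θ₀ u₀ ha hθ hu ha0 hθ0
  obtain ⟨σ₁, hσ₁, H1⟩ := hIso a₀ θ₀ u₀ ha hθ hu ha0 hθ0
  obtain ⟨σ₂, hσ₂, H2⟩ := hStr a₀ θ₀ u₀ ha hθ hu ha0 hθ0
  refine ⟨min σ₁ σ₂, lt_min hσ₁ hσ₂, ?_⟩
  intro σ hσ hσlt T ρ θ u hE Φ h0 hT τ hτ φ hφ _hφ0 _hsupp c η₁ hc η δ hη hδ
  have hσ1 : σ < σ₁ := lt_of_lt_of_le hσlt (min_le_left _ _)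
  have hσ2 : σ < σ₂ := lt_of_lt_of_le hσlt (min_le_right _ _)
  have hδ2 : 0 < δ / 2 := by positivity
  -- the weight bound `M + 1 > 0` on `[0,τ] × 𝕋³`
  obtain ⟨M₀, hM₀⟩ := hφ.exists_norm_le_of_isCompact isCompact_Icc (Set.subset_univ (Set.Icc (0 : ℝ) τ))
  set M : ℝ := max M₀ 0 with hMdef
  have hM0 : 0 ≤ M := le_max_right _ _
  have hM : ∀ s ∈ Set.Icc (0 : ℝ) τ, ∀ x, |φ s x| ≤ M := fun s hs x => by
    rw [← Real.norm_eq_abs]; exact (hM₀ s hs x).trans (le_max_left _ _)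
  -- strain tightness at `δ/2`
  obtain ⟨K, hK, r₂, hr₂, H2'⟩ := H2 σ hσ hσ2 T ρ θ u hE Φ h0 hT τ hτ c η₁ hc (δ / 2) hδ2
  -- isotropy at level `η c / ((M + 1) K)`, `δ/2`
  have hη' : 0 < η * c / ((M + 1) * K) := by positivity
  obtain ⟨r₁, hr₁, H1'⟩ :=
    H1 σ hσ hσ1 T ρ θ u hE Φ h0 hT τ hτ c η₁ hc (η * c / ((M + 1) * K)) (δ / 2) hη' hδ2
  refine ⟨min r₁ r₂, lt_min hr₁ hr₂, ?_⟩
  intro r hr hrlt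
  have hr1 : r < r₁ := lt_of_lt_of_le hrlt (min_le_left _ _)
  have hr2 : r < r₂ := lt_of_lt_of_le hrlt (min_le_right _ _)
  obtain ⟨N₁, HN1⟩ := H1' r hr hr1
  obtain ⟨N₂, HN2⟩ := H2' r hr hr2
  refine ⟨max N₁ N₂, fun N hN => ?_⟩
  have E1 := HN1 N ((le_max_left _ _).trans hN)
  have E2 := HN2 N ((le_max_right _ _).trans hN)
  -- event inclusion: off both exceptional events the deterministic core gives `T₁ ≥ -η`
  have hsub : {z | Regular σ r τ c η₁ (Φ N) z ∧ T₁ σ r τ φ (Φ N) z < -η} ⊆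
      {z | Regular σ r τ c η₁ (Φ N) z ∧
          η * c / ((M + 1) * K) * r < ∫ s in Set.Icc (0 : ℝ) τ, ∫ x : T3,
            ∑ k : Fin 3, ∑ l : Fin 3, |devC r ((Φ N).flow s z) x k l|} ∪
        {z | Regular σ r τ c η₁ (Φ N) z ∧
          ∃ s ∈ Set.Icc (0 : ℝ) τ, ∃ x : T3, ∃ k l : Fin 3,
            K < r * |pD k (fun y => uC r ((Φ N).flow s z) y l) x|} := by
    rintro z ⟨hReg, hT⟩
    by_contra hcon
    simp only [Set.mem_union, Set.mem_setOf_eq, not_or, not_and, not_lt, not_exists] at hcon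
    obtain ⟨hA, hB⟩ := hcon
    have hA' := hA hReg
    have hB' : ∀ s ∈ Set.Icc (0 : ℝ) τ, ∀ x, ∀ k l : Fin 3,
        r * |pD k (fun y => uC r ((Φ N).flow s z) y l) x| ≤ K := fun s hs x k l => hB hReg s hs x k l
    have hcore := psvK_abs_T₁_le hr hc hτ.le hReg hM hB'
    have hI0 : 0 ≤ ∫ s in Set.Icc (0 : ℝ) τ, ∫ x : T3,
        ∑ k : Fin 3, ∑ l : Fin 3, |devC r ((Φ N).flow s z) x k l| :=
      setIntegral_nonneg measurableSet_Icc fun s _ =>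
        integral_nonneg fun x => Finset.sum_nonneg fun k _ => Finset.sum_nonneg fun l _ => abs_nonneg _
    have hW : 0 ≤ M * K / (c * r) := by positivity
    have h1 : |T₁ σ r τ φ (Φ N) z| ≤ M * K / (c * r) * (η * c / ((M + 1) * K) * r) :=
      hcore.trans (mul_le_mul_of_nonneg_left hA' hW)
    have h2 : M * K / (c * r) * (η * c / ((M + 1) * K) * r) = η * (M / (M + 1)) := by
      field_simp
    have h3 : η * (M / (M + 1)) < η := by
      have : M / (M + 1) < 1 := by rw [div_lt_one (by positivity)]; linarith
      nlinarith
    have h4 : -η < T₁ σ r τ φ (Φ N) z := by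
      have := neg_abs_le (T₁ σ r τ φ (Φ N) z)
      linarith
    linarith
  calc localGibbsLaw σ a₀ u₀ θ₀ N (Φ N) {z | Regular σ r τ c η₁ (Φ N) z ∧ T₁ σ r τ φ (Φ N) z < -η}
      ≤ localGibbsLaw σ a₀ u₀ θ₀ N (Φ N)
          ({z | Regular σ r τ c η₁ (Φ N) z ∧
              η * c / ((M + 1) * K) * r < ∫ s in Set.Icc (0 : ℝ) τ, ∫ x : T3,
                ∑ k : Fin 3, ∑ l : Fin 3, |devC r ((Φ N).flow s z) x k l|} ∪
            {z | Regular σ r τ c η₁ (Φ N) z ∧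
              ∃ s ∈ Set.Icc (0 : ℝ) τ, ∃ x : T3, ∃ k l : Fin 3,
                K < r * |pD k (fun y => uC r ((Φ N).flow s z) y l) x|}) := measure_mono hsub
    _ ≤ _ := measure_union_le _ _
    _ ≤ ENNReal.ofReal (δ / 2) + ENNReal.ofReal (δ / 2) := add_le_add E1 E2
    _ = ENNReal.ofReal δ := by rw [← ENNReal.ofReal_add hδ2.le hδ2.le, add_halves]


end Summit.AtomisticToContinuum.HydrodynamicLimit.Theorems.LocalSecondLawLedger

end
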